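import Literature.MathematicalPhysics.QuantumFieldTheory.WilsonFinTorusSpectralData
import Literature.Analysis.OperatorTheory.SlabFibreContraction
import HarnessLib

/-!
# Route `SqueezedSkewness`, support `ThermalLimit` (stmt-QuantumFields-22661) — engine layer (B1):
# `Fin`-TORUS INTEGRALS AS CYCLIC SLAB INTEGRALS OVER (SLICES, TEMPORAL LINKS)

The `Fin`-torus twin of the slicing half of `WilsonTorusSlabCorrelators` (p644993).  Setting: the anisotropic box
`b₁ × b₂ × b₃ × T` of `wilsonFinTorusPartition ρ β b₁ b₂ b₃ T` (time = the LAST axis, the convention of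
`SqueezedSkewness.ThermalLimit`), continuous unitary `ρ`; the slicing `finTorusAssemble (V, E)` of `WilsonFinTorusSliceKernel`
(spatial slices `V t`, temporal links `E t`) and the symmetrised slab weight
`c(a, g, b) = e^{−βS_sp(a)/2} e^{−βS_tm(a,g,b)} e^{−βS_sp(b)/2}` (written out, no definition; `∫ c dg = finTorusSliceKernel`).

PROVED (theorems only; `[folklore]` transfer-matrix bookkeeping, Montvay–Münster §3.2.6 (3.137)–(3.146)):
* §1 measurability, `0 ≤ c ≤ 1` (`β ≥ 0`), `∫ c(a,g,b) dg = K_β(a,b)`;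
* §2 `integral_mul_weight_eq_slab` — `∫ Φ e^{−βS} ∏dU = ∫ Φ(asm(V,E)) ∏ₜ c(Vₜ,Eₜ,Vₜ₊₁) d(∏dV ⊗ ∏dE)` (slicing is measure
  preserving, the weight factorises over slabs, the spatial factors are split half-and-half around the cycle);
* §3 `integral_mul_weight_eq_slab_zmod` — the same in the `ZMod`-indexed letters of the abstract slab toolkit
  `Literature.Analysis.OperatorTheory.slab_cyclic_*` (relabelling `Fin T ≃ ZMod T`), and the rotation ∕ window-arithmetic
  helpers `integral_rotate_zmod`, `cast_castLE_add` used by layer (B2) `…FinTorusWindow` (window observables as one-insertion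
  traces and their thermodynamic limit).
Width seat `ym-t4-w9` (cell ym-fleet), `--supports stmt-QuantumFields-22661`; rung R2a plumbing; no summit ∕ NT ∕ UV ∕ IR ∕
mass-gap statement is proved.

References: I. Montvay, G. Münster, *Quantum Fields on a Lattice* (1994) §3.2.6 (3.137)–(3.146); M. Lüscher,
Commun. Math. Phys. 54 (1977) 283; K. Osterwalder, E. Seiler, Ann. Phys. 110 (1978) 440, §§2–3.
-/

set_option autoImplicit false

noncomputable section

open scoped BigOperators ENNReal
open MeasureTheory Filter Function Topology
open Literature.MathematicalPhysics.QuantumFieldTheory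
open Literature.Analysis.OperatorTheory

namespace Summit.QuantumFields.YangMills.Theorems.FinTorusSlabCycle

variable {b₁ b₂ b₃ : ℕ} {G : Type*} [Group G] [TopologicalSpace G] [IsTopologicalGroup G] [CompactSpace G]
  [MeasurableSpace G] [BorelSpace G] [SecondCountableTopology G] {N : ℕ} (ρ : G →* Matrix (Fin N) (Fin N) ℂ) (β : ℝ)

/-! ## §1 The symmetrised slab weight (written out) -/

omit [CompactSpace G] in
/-- **Measurability of the symmetrised slab weight**
`c(a, g, b) = e^{−β S_sp(a)/2} e^{−β S_tm(a,g,b)} e^{−β S_sp(b)/2}` jointly in `(a, g, b)`. [cite: MontvayMunster1994, §3.2.6 (3.140)–(3.144)] -/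
theorem measurable_slabWeight (hρ : Continuous ρ) :
    Measurable fun q : (FinSpatialSite b₁ b₂ b₃ × Fin 3 → G) × (FinSpatialSite b₁ b₂ b₃ → G) ×
        (FinSpatialSite b₁ b₂ b₃ × Fin 3 → G) =>
      Real.exp (-(β * finTorusSpatialAction ρ q.1 / 2)) * Real.exp (-(β * finTorusTemporalAction ρ q.1 q.2.1 q.2.2)) *
        Real.exp (-(β * finTorusSpatialAction ρ q.2.2 / 2)) := by
  have hS := (continuous_finTorusSpatialAction (b₁ := b₁) (b₂ := b₂) (b₃ := b₃) ρ hρ).measurable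
  have hT := (continuous_finTorusTemporalAction (b₁ := b₁) (b₂ := b₂) (b₃ := b₃) ρ hρ).measurable
  exact ((((hS.comp measurable_fst).const_mul β).div_const 2).neg.exp.mul (hT.const_mul β).neg.exp).mul
    (((hS.comp (measurable_snd.comp measurable_snd)).const_mul β).div_const 2).neg.exp

omit [TopologicalSpace G] [IsTopologicalGroup G] [CompactSpace G] [MeasurableSpace G] [BorelSpace G]
  [SecondCountableTopology G] in
/-- `0 ≤ c ≤ 1` for `β ≥ 0` and unitary `ρ`. [cite: MontvayMunster1994, §3.2.2 (3.67)] -/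
theorem slabWeight_nonneg_le_one (hρu : ∀ g, ρ g ∈ Matrix.unitaryGroup (Fin N) ℂ) (hβ : 0 ≤ β)
    (a : FinSpatialSite b₁ b₂ b₃ × Fin 3 → G) (g : FinSpatialSite b₁ b₂ b₃ → G) (b : FinSpatialSite b₁ b₂ b₃ × Fin 3 → G) :
    0 ≤ Real.exp (-(β * finTorusSpatialAction ρ a / 2)) * Real.exp (-(β * finTorusTemporalAction ρ a g b)) *
        Real.exp (-(β * finTorusSpatialAction ρ b / 2)) ∧
      Real.exp (-(β * finTorusSpatialAction ρ a / 2)) * Real.exp (-(β * finTorusTemporalAction ρ a g b)) *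
        Real.exp (-(β * finTorusSpatialAction ρ b / 2)) ≤ 1 :=
  ⟨by positivity,
    mul_le_one₀ (mul_le_one₀ (exp_neg_half_finTorusSpatialAction_le_one ρ hρu hβ a) (Real.exp_pos _).le
      (exp_neg_finTorusTemporalAction_le_one ρ hρu hβ a g b)) (Real.exp_pos _).le
      (exp_neg_half_finTorusSpatialAction_le_one ρ hρu hβ b)⟩

omit [SecondCountableTopology G] in
/-- `∫ c(a, g, b) dg = K_β(a, b)`: the Haar average of the slab weight over the temporal links is the slice kernel
`finTorusSliceKernel`. [cite: MontvayMunster1994, §3.2.6 (3.144)] -/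
theorem integral_slabWeight (a b : FinSpatialSite b₁ b₂ b₃ × Fin 3 → G) :
    ∫ g, Real.exp (-(β * finTorusSpatialAction ρ a / 2)) * Real.exp (-(β * finTorusTemporalAction ρ a g b)) *
        Real.exp (-(β * finTorusSpatialAction ρ b / 2)) ∂(Measure.pi fun _ : FinSpatialSite b₁ b₂ b₃ => haarProbability G) =
      finTorusSliceKernel ρ β a b := by
  unfold finTorusSliceKernel
  rw [integral_mul_const, integral_const_mul]

/-! ## §2 Torus integrals as cyclic slab integrals over (slices, temporal links) -/

omit [TopologicalSpace G] [IsTopologicalGroup G] [CompactSpace G] [MeasurableSpace G] [BorelSpace G]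
  [SecondCountableTopology G] in
/-- Regrouping the spatial factors half-and-half around the cycle:
`(∏ₜ e^{−βS_sp(Vₜ)}) ∏ₜ e^{−βS_tm(Vₜ,Eₜ,Vₜ₊₁)} = ∏ₜ c(Vₜ, Eₜ, Vₜ₊₁)`. [cite: MontvayMunster1994, §3.2.6 (3.142)–(3.144)] -/
theorem prod_weight_regroup {m : ℕ} (V : Fin m → (FinSpatialSite b₁ b₂ b₃ × Fin 3 → G))
    (E : Fin m → (FinSpatialSite b₁ b₂ b₃ → G)) :
    (∏ t : Fin m, Real.exp (-(β * finTorusSpatialAction ρ (V t)))) *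
        ∏ t : Fin m, Real.exp (-(β * finTorusTemporalAction ρ (V t) (E t) (V (finRotate m t)))) =
      ∏ t : Fin m, Real.exp (-(β * finTorusSpatialAction ρ (V t) / 2)) *
        Real.exp (-(β * finTorusTemporalAction ρ (V t) (E t) (V (finRotate m t)))) *
          Real.exp (-(β * finTorusSpatialAction ρ (V (finRotate m t)) / 2)) := by
  rw [Finset.prod_mul_distrib, Finset.prod_mul_distrib]
  have hrot : ∏ t : Fin m, Real.exp (-(β * finTorusSpatialAction ρ (V (finRotate m t)) / 2)) =
      ∏ t : Fin m, Real.exp (-(β * finTorusSpatialAction ρ (V t) / 2)) :=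
    Equiv.prod_comp (finRotate m) (fun t => Real.exp (-(β * finTorusSpatialAction ρ (V t) / 2)))
  rw [hrot]
  have hsq : ∀ t : Fin m, Real.exp (-(β * finTorusSpatialAction ρ (V t))) =
      Real.exp (-(β * finTorusSpatialAction ρ (V t) / 2)) * Real.exp (-(β * finTorusSpatialAction ρ (V t) / 2)) := by
    intro t; rw [← Real.exp_add]; ring_nf
  simp_rw [hsq]
  rw [Finset.prod_mul_distrib]
  ring

/-- **Un-normalised `Fin`-torus integrals as cyclic slab integrals**: for measurable `Φ`,
`∫ Φ(U) e^{−β S(U)} ∏ dU = ∫ Φ(asm(V,E)) ∏ₜ c(Vₜ, Eₜ, Vₜ₊₁) d(∏ dV ⊗ ∏ dE)` (`t + 1 = finRotate m t`).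
[cite: MontvayMunster1994, §3.2.6 (3.145)] -/
theorem integral_mul_weight_eq_slab (hρ : Continuous ρ) {m : ℕ}
    {Φ : (FinTorusSite b₁ b₂ b₃ m × Fin 4 → G) → ℝ} (hΦ : Measurable Φ) :
    ∫ U, Φ U * Real.exp (-β * ∑ x : FinTorusSite b₁ b₂ b₃ m, ∑ q : {q : Fin 4 × Fin 4 // q.1 < q.2},
        ((N : ℝ) - (ρ (finTorusPlaquette U x q.1.1 q.1.2)).trace.re))
        ∂(Measure.pi fun _ : FinTorusSite b₁ b₂ b₃ m × Fin 4 => haarProbability G) =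
      ∫ VE, Φ (finTorusAssemble VE) * ∏ t : Fin m, Real.exp (-(β * finTorusSpatialAction ρ (VE.1 t) / 2)) *
          Real.exp (-(β * finTorusTemporalAction ρ (VE.1 t) (VE.2 t) (VE.1 (finRotate m t)))) *
            Real.exp (-(β * finTorusSpatialAction ρ (VE.1 (finRotate m t)) / 2))
        ∂((Measure.pi fun _ : Fin m => Measure.pi fun _ : FinSpatialSite b₁ b₂ b₃ × Fin 3 => haarProbability G).prod
          (Measure.pi fun _ : Fin m => Measure.pi fun _ : FinSpatialSite b₁ b₂ b₃ => haarProbability G)) := by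
  have hw := (continuous_finTorusBoltzmannWeight (b₁ := b₁) (b₂ := b₂) (b₃ := b₃) (m := m) ρ hρ β).measurable
  rw [integral_pi_eq_integral_finTorusAssemble (haarProbability G)
    (Φ := fun U => Φ U * Real.exp (-β * ∑ x : FinTorusSite b₁ b₂ b₃ m, ∑ q : {q : Fin 4 × Fin 4 // q.1 < q.2},
        ((N : ℝ) - (ρ (finTorusPlaquette U x q.1.1 q.1.2)).trace.re))) (hΦ.mul hw)]
  refine integral_congr_ae (Eventually.of_forall fun VE => ?_)
  dsimp only
  rw [finTorusWeight_assemble ρ β VE, prod_weight_regroup ρ β VE.1 VE.2]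

/-! ## §3 Relabelling the time cycle `Fin (k+1) ≃ ZMod (k+1)` (the abstract slab toolkit is `ZMod`-indexed) -/

/-- **Relabelling a product-of-products integral** along `e : S ≃ ι` (both factors at once). [folklore] -/
theorem integral_prod_pi_relabel {X Y S ι : Type*} [MeasurableSpace X] [MeasurableSpace Y] [Fintype S] [Fintype ι]
    (μ : Measure X) (ν : Measure Y) [SigmaFinite μ] [SigmaFinite ν] (e : S ≃ ι) (F : (ι → X) × (ι → Y) → ℝ) :
    ∫ p, F p ∂((Measure.pi fun _ : ι => μ).prod (Measure.pi fun _ : ι => ν)) =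
      ∫ q, F (fun t => q.1 (e.symm t), fun t => q.2 (e.symm t)) ∂((Measure.pi fun _ : S => μ).prod (Measure.pi fun _ : S => ν)) := by
  set eX := MeasurableEquiv.piCongrLeft (fun _ : ι => X) e with heX
  set eY := MeasurableEquiv.piCongrLeft (fun _ : ι => Y) e with heY
  have hX : MeasurePreserving eX (Measure.pi fun _ : S => μ) (Measure.pi fun _ : ι => μ) :=
    measurePreserving_piCongrLeft (fun _ : ι => μ) e
  have hY : MeasurePreserving eY (Measure.pi fun _ : S => ν) (Measure.pi fun _ : ι => ν) :=
    measurePreserving_piCongrLeft (fun _ : ι => ν) e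
  have heXa : ∀ V : S → X, eX V = fun t => V (e.symm t) := fun V => by
    funext i
    simp only [heX, MeasurableEquiv.coe_piCongrLeft, Equiv.piCongrLeft_apply_eq_cast, cast_eq]
  have heYa : ∀ V : S → Y, eY V = fun t => V (e.symm t) := fun V => by
    funext i
    simp only [heY, MeasurableEquiv.coe_piCongrLeft, Equiv.piCongrLeft_apply_eq_cast, cast_eq]
  have h' : MeasurePreserving (MeasurableEquiv.prodCongr eX eY)
      ((Measure.pi fun _ : S => μ).prod (Measure.pi fun _ : S => ν))
      ((Measure.pi fun _ : ι => μ).prod (Measure.pi fun _ : ι => ν)) := hX.prod hY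
  have happ : ∀ q : (S → X) × (S → Y),
      (MeasurableEquiv.prodCongr eX eY) q = (fun t => q.1 (e.symm t), fun t => q.2 (e.symm t)) := by
    intro q
    show Prod.map eX eY q = _
    rw [Prod.map_apply, heXa, heYa]
  rw [← h'.integral_comp' F]
  simp only [happ]

/-- **The cyclic slab integral in the toolkit's `ZMod` letters**: for measurable `Φ` on the `Fin`-torus of period
`k + 1`, `∫ Φ e^{−βS} ∏ dU = ∫ Φ(asm(t ↦ V_{t mod (k+1)}, t ↦ E_{t mod (k+1)})) ∏_{s : ZMod (k+1)} c(V s, E s, V (s+1))`.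
[cite: MontvayMunster1994, §3.2.6 (3.145)] -/
theorem integral_mul_weight_eq_slab_zmod (hρ : Continuous ρ) {k : ℕ}
    {Φ : (FinTorusSite b₁ b₂ b₃ (k + 1) × Fin 4 → G) → ℝ} (hΦ : Measurable Φ) :
    ∫ U, Φ U * Real.exp (-β * ∑ x : FinTorusSite b₁ b₂ b₃ (k + 1), ∑ q : {q : Fin 4 × Fin 4 // q.1 < q.2},
        ((N : ℝ) - (ρ (finTorusPlaquette U x q.1.1 q.1.2)).trace.re))
        ∂(Measure.pi fun _ : FinTorusSite b₁ b₂ b₃ (k + 1) × Fin 4 => haarProbability G) =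
      ∫ p : (ZMod (k + 1) → (FinSpatialSite b₁ b₂ b₃ × Fin 3 → G)) × (ZMod (k + 1) → (FinSpatialSite b₁ b₂ b₃ → G)),
        Φ (finTorusAssemble (fun t : Fin (k + 1) => p.1 ((t : ℕ) : ZMod (k + 1)),
            fun t : Fin (k + 1) => p.2 ((t : ℕ) : ZMod (k + 1)))) *
          ∏ s : ZMod (k + 1), Real.exp (-(β * finTorusSpatialAction ρ (p.1 s) / 2)) *
            Real.exp (-(β * finTorusTemporalAction ρ (p.1 s) (p.2 s) (p.1 (s + 1)))) *
              Real.exp (-(β * finTorusSpatialAction ρ (p.1 (s + 1)) / 2))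
        ∂((Measure.pi fun _ : ZMod (k + 1) => Measure.pi fun _ : FinSpatialSite b₁ b₂ b₃ × Fin 3 => haarProbability G).prod
          (Measure.pi fun _ : ZMod (k + 1) => Measure.pi fun _ : FinSpatialSite b₁ b₂ b₃ => haarProbability G)) := by
  rw [integral_mul_weight_eq_slab ρ β hρ hΦ]
  obtain ⟨ez, hez⟩ := slab_zmod_equiv (N := k + 1) (fun t : Fin (k + 1) => (t : ℕ)) (fun t => t.isLt)
    (fun t t' h => Fin.ext h) (by simp)
  rw [integral_prod_pi_relabel _ _ ez.symm]
  refine integral_congr_ae (Eventually.of_forall fun q => ?_)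
  dsimp only
  simp only [Equiv.symm_symm]
  have hV : (fun t : Fin (k + 1) => q.1 (ez t)) = fun t : Fin (k + 1) => q.1 ((t : ℕ) : ZMod (k + 1)) := by
    funext t; rw [hez]
  have hE : (fun t : Fin (k + 1) => q.2 (ez t)) = fun t : Fin (k + 1) => q.2 ((t : ℕ) : ZMod (k + 1)) := by
    funext t; rw [hez]
  rw [hV, hE]
  congr 1
  -- the weight: reindex the cyclic product along `ez`, `ez (t+1) = ez t + 1`
  simp only [finRotate_apply]
  refine Fintype.prod_equiv ez _ _ fun t => ?_
  have h1 : ez (t + 1) = ez t + 1 := by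
    rw [hez, hez]; exact (slab_cast_add_one (N := k + 1) rfl t).symm
  rw [h1]

/-! ## §3′ Rotations of the time cycle and window arithmetic -/

/-- Relabelling the `ZMod N` cycle by a translation preserves the product of the slice and temporal-link measures.
[folklore] -/
theorem integral_rotate_zmod {X Y : Type*} [MeasurableSpace X] [MeasurableSpace Y] {n : ℕ} [NeZero n]
    (μ : Measure X) (ν : Measure Y) [SigmaFinite μ] [SigmaFinite ν] (c₀ : ZMod n) (F : (ZMod n → X) × (ZMod n → Y) → ℝ) :
    ∫ q, F (fun τ => q.1 (τ + c₀), fun τ => q.2 (τ + c₀)) ∂((Measure.pi fun _ : ZMod n => μ).prod (Measure.pi fun _ : ZMod n => ν)) =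
      ∫ p, F p ∂((Measure.pi fun _ : ZMod n => μ).prod (Measure.pi fun _ : ZMod n => ν)) := by
  have h := integral_prod_pi_relabel μ ν (Equiv.addRight c₀).symm F
  rw [h]
  simp only [Equiv.symm_symm, Equiv.coe_addRight]

/-- Successor arithmetic of a rotated window: `↑↑(castLE i + c) = ↑↑i + ↑↑c` in `ZMod (k+1)`. [folklore] -/
theorem cast_castLE_add {k n : ℕ} (h : n ≤ k + 1) (i : Fin n) (c : Fin (k + 1)) :
    (((Fin.castLE h i + c : Fin (k + 1)) : ℕ) : ZMod (k + 1)) = ((i : ℕ) : ZMod (k + 1)) + ((c : ℕ) : ZMod (k + 1)) := by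
  rw [Fin.val_add, ZMod.natCast_mod, Nat.cast_add, Fin.val_castLE]

end Summit.QuantumFields.YangMills.Theorems.FinTorusSlabCycle

end
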